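/-
Copyright (c) 2026 the pub-hodgecm-mathlib formalisation cell (harness21).  Prover seat hodgecm-mathlib-K2Liu-p02 (g10), Track B «K2-LIT» ∕ hLiu418
#184♮, Road I v3, unit U5 «THE CLOSE», FACE-D₀ (theta side, route (B3) «global unfolding»), brick B3-3 ED. 2 «HERMITIAN-GUARDED LETTERS» (K2E3-p37 (g4)'s
by-value face finding, K2 bus 2026-09-05T03:28:36Z): the fibre∕support letters of ★ p865025 hold only on HERMITIAN indices (resp. `T_L`-SKEW Fourier indices) —
`ψ_S` depends on `S` only modulo hermitian-type matrices (★ `unipDeltaChar_eq_one_of_herm`).  Own module (★ p865025 stays byte-identical).  THEOREMS ONLY.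
-/
import Summits.HodgeConjecture.HodgeConjecture.Theorems.K2LiuThetaSideRankOneIndexGlobalGram   -- this seat ★ p865025: §1 `exists_eq_mul_conj_mul_self_of_support`, `dictNeg_injective`
import Summits.HodgeConjecture.HodgeConjecture.Theorems.K2LiuHermitianSkewDictionary          -- F0P2-p10 ★ p864231: `dict_mem_skewMatrices`
import HarnessLib

/-!
# K2_Liu road (hLiu418 = stmt-HodgeConjecture-24832), FACE-D₀ route (B3), brick B3-3 ED. 2: the HERMITIAN-GUARDED fibre letters

Cell `pub/hodgecm-mathlib` (D-0151), Track B, build stream 29; helper lane `--supports stmt-HodgeConjecture-24832 --as helper`, count-neutral; closes no socket.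

WHY (K2E3-p37 (g4), by-value face finding on ★ p865025, accepted by the FACE-D₀ desk).  The unipotent character `ψ_S` of `N_Δ(𝔸)` is TRIVIAL for hermitian-type
`S` (★ `K2LiuSiegelUnipotentCharacters.unipDeltaChar_eq_one_of_herm`), so a Fourier coefficient `cf_S` depends on `S` only modulo hermitian-type matrices, and the
conjugate dictionary `dict′ β = (−δ) • (T_L⁻¹ · β^{ρ⁻¹})` carries hermitian `β` to skew `S` and ANTI-hermitian `β` to hermitian-type `S`.  Hence ★ p865025's
unguarded letters `hfib` (`∀ β : Matrix (Fin 2) (Fin 2) L`) and `hsupp` (`∀ S`) are unpayable as soon as one coefficient survives (`β = β_h + β_a` with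
`cf_{dict′ β} = cf_{dict′ β_h} ≠ 0` but `β` no Gram).  Nothing stronger than the GUARDED letters is true, and nothing stronger is needed: the surviving rank-one
index `b • ū ⊗ u` of the FACE-D₀ rows IS hermitian (★ `map_transpose_smul_vecMulVec_conj`) and `dict′` of a hermitian `β` IS `T_L`-skew (★ p864231
`dict_mem_skewMatrices`, `neg_mem`).  THIS FILE re-issues the three consumable heads of ★ p865025 with the guards:
* `hfib` guarded: `∀ β, (β.map c)ᵀ = β → (∃ x h, cf_{dict′ β}(T x) h ≠ 0) → ∃ ξ, β = a′ • c(ξ) ⊗ ξ`;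
* `hsupp` guarded (B3-2b's `exists_index_eq_of_cf_thetaSide_ne_zero` VERBATIM in shape): `∀ S ∈ skewMatrices c T_L, (∃ x h, cf_S(T x) h ≠ 0) → ∃ ξ, Q ξ = S`.
Heads: `isHerm_smul_vecMulVec_conj` (the surviving index is hermitian), `dictNeg_mem_skewMatrices` (`dict′` of a hermitian index is skew),
`exists_globalGram_of_fourierCoeff_ne_zero_herm` (§2 twin), `hfib_of_indexMap_skew` (the adapter from B3-2b∕B3-2c's GUARDED outputs),
`exists_globalGram_of_cf_thetaSide_ne_zero_herm` (§3 twin, the theta side of record through `hT₂B`).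
No definition, no instance, no notation, no named-fact hypothesis, no `sorry`; axioms ⊆ {propext, Classical.choice, Quot.sound}.
HONEST LABEL: `hsign₂′`∕`hloc₂′` NOT discharged by this file (middle brick; the guarded `hfib` is by value until B3-2b∕B3-2c are ★); HC_CM is proved only modulo the
7 printed citations (2 remaining named inputs: hLiu418 = stmt-HodgeConjecture-24832, h413 = stmt-HodgeConjecture-24833) until rung 0 closes; count-neutral.

References: [KudlaRallis1994] §3; [Shimura1997] §18.1 (18.4); [Tan1999] §3; [Scharlau1985HermitianForms] Ch. 10 §1; [Liu2021] Def. 4.11–4.12, App. B Prop. B.8 p. 104.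
-/

set_option autoImplicit false
set_option linter.dupNamespace false -- the mandated namespace repeats `HodgeConjecture.HodgeConjecture`
-- §3 carries the line datum's `pairRep` telescope; elaborate sequentially (as in ★ p864604 ∕ ★ p865025)
set_option Elab.async false

noncomputable section

open NumberField NumberField.mixedEmbedding MeasureTheory IsDedekindDomain
open scoped Matrix ComplexOrder ENNReal TensorProduct SchwartzMap

namespace Summit.HodgeConjecture.HodgeConjecture.Cruxes.HLiu418.K2LiuThetaSideRankOneIndexGlobalGramHerm

open Literature.NumberTheory.Automorphic Literature.NumberTheory.Automorphic.UnitaryGroup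
open Literature.NumberTheory.Automorphic.IdeleClassGroup
open Literature.NumberTheory.Automorphic.Liu2021
open Literature.NumberTheory.Automorphic.Liu2021.Def411WeilCarriers
open Literature.NumberTheory.Automorphic.Liu2021.Def411WeilCarriersDoubling
open Literature.NumberTheory.GelbartRogawski1991 Literature.NumberTheory.GelbartRogawski1991.UnitaryDualPair
open Literature.NumberTheory.GelbartRogawski1991.GRConstruction
open Literature.NumberTheory.Weil1964
open Literature.RepresentationTheory Literature.RepresentationTheory.Liu2021
open Literature.NumberTheory.K2Lit.DoubledLineTheta Literature.NumberTheory.K2Lit.SiegelDoubled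
open Summit.HodgeConjecture.HodgeConjecture.Cruxes.HLiu418.K2LiuSiegelUnipotentFourierDefs
open Summit.HodgeConjecture.HodgeConjecture.Cruxes.HLiu418.K2LiuRankOneLineGram (map_transpose_smul_vecMulVec_conj)
open Summit.HodgeConjecture.HodgeConjecture.Cruxes.HLiu418.K2LiuHermitianSkewDictionary (dict_mem_skewMatrices)
open Summit.HodgeConjecture.HodgeConjecture.Cruxes.HLiu418.K2LiuThetaSideRankOneIndexGlobalGram (exists_eq_mul_conj_mul_self_of_support dictNeg_injective)

/-! ## §1 The two guards are met by the FACE-D₀ rows' indices -/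

section Guards

variable (L : Type) [Field L] [NumberField L] [IsCMField L]

/-- **the surviving rank-one index `b • ū ⊗ u` (`b ∈ L⁺`) is hermitian**: `((b • c(u) ⊗ u).map c)ᵀ = b • c(u) ⊗ u` (★ `map_transpose_smul_vecMulVec_conj` with
`c ∘ c = id`, `c b = b`). [cite: Scharlau1985HermitianForms, Ch. 10 §1] -/
theorem isHerm_smul_vecMulVec_conj (b : Fp L) (u : Fin 2 → L) :
    ((algebraMap (Fp L) L b • Matrix.vecMulVec (⇑(IsCMField.complexConj L) ∘ u) u).map (IsCMField.complexConj L))ᵀ =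
      algebraMap (Fp L) L b • Matrix.vecMulVec (⇑(IsCMField.complexConj L) ∘ u) u :=
  map_transpose_smul_vecMulVec_conj (IsCMField.complexConj L : L →+* L) (IsCMField.complexConj_apply_apply (K := L))
    ((IsCMField.complexConj_eq_self_iff (K := L) _).2 (Subtype.coe_prop b)) u

variable {N n : ℕ} (e : Fin N × Fin 1 ≃ Fin n)
  (dV : Fin N → L) (hdV : ∀ i, IsCMField.complexConj L (dV i) = dV i)
  (dW : Fin 1 → L) (hdW : ∀ i, IsCMField.complexConj L (dW i) = dW i) (ρ : Fin n ≃ Fin 2)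

/-- **`dict′` of a hermitian index is `T_L`-skew**: `(−δ) • (T_L⁻¹ · β^{ρ⁻¹}) ∈ Skew_{T_L}` for `(β.map c)ᵀ = β` (★ p864231 `dict_mem_skewMatrices`, `neg_mem`).
[cite: Shimura1997, §18.1 (18.4)] -/
theorem dictNeg_mem_skewMatrices (hdV0 : ∀ i, dV i ≠ 0) (hdW0 : ∀ i, dW i ≠ 0) {β : Matrix (Fin 2) (Fin 2) L}
    (hβ : (β.map (IsCMField.complexConj L))ᵀ = β) :
    (-imagUnit L) • (((gramR L e dV hdV dW hdW).map (algebraMap (Fp L) L))⁻¹ * Matrix.reindex ρ.symm ρ.symm β) ∈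
      skewMatrices ((IsCMField.complexConj L : L ≃ₐ[Fp L] L) : L →+* L) ((gramR L e dV hdV dW hdW).map (algebraMap (Fp L) L)) := by
  rw [neg_smul]
  exact neg_mem (dict_mem_skewMatrices L e dV hdV dW hdW hdV0 hdW0 ρ β hβ)

end Guards

/-! ## §2 The guarded Fourier-coefficient heads for any family of functions on `H(𝔸)` (index bytes of ED. 2, keying `−δ`) -/

section Coeff

variable (L : Type) [Field L] [NumberField L] [IsCMField L]
variable {N n : ℕ} (e : Fin N × Fin 1 ≃ Fin n)
  (dV : Fin N → L) (hdV : ∀ i, IsCMField.complexConj L (dV i) = dV i)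
  (dW : Fin 1 → L) (hdW : ∀ i, IsCMField.complexConj L (dW i) = dW i)
  [MeasurableSpace (unipDelta L e dV hdV dW hdW)] (νN : Measure (unipDelta L e dV hdV dW hdW))
  (βw : unipDelta L e dV hdV dW hdW → ℝ≥0∞) (ρ : Fin n ≃ Fin 2) (a' : (Fp L)ˣ)

/-- **B3-3 AT THE FOURIER-COEFFICIENT LEVEL, ANY SIDE `T`, HERMITIAN GUARD.**  If the Fourier coefficients of the family `T` at the conjugate-dictionary indices of
HERMITIAN `β` are supported on the Grams of the line `⟨a′⟩` (`hfib`, guarded — the only payable form), then every surviving rank-one index `b • ū ⊗ u` (`u` with a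
coordinate `1`) is a global Gram: `b = a′ · c(e) · e`. [cite: KudlaRallis1994, §3] [cite: Scharlau1985HermitianForms, Ch. 10 §1] [cite: Shimura1997, §18.1 (18.4)] -/
theorem exists_globalGram_of_fourierCoeff_ne_zero_herm {ι : Type*} (T : ι → HA L e dV hdV dW hdW → ℂ)
    (hfib : ∀ β : Matrix (Fin 2) (Fin 2) L, (β.map (IsCMField.complexConj L))ᵀ = β →
      (∃ (x : ι) (h : HA L e dV hdV dW hdW),
        fourierCoeffDelta L e dV hdV dW hdW νN βw
          ((-imagUnit L) • (((gramR L e dV hdV dW hdW).map (algebraMap (Fp L) L))⁻¹ * Matrix.reindex ρ.symm ρ.symm β)) (T x) h ≠ 0) →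
      ∃ ξ : Fin 2 → L, β = algebraMap (Fp L) L (a' : Fp L) • Matrix.vecMulVec (⇑(IsCMField.complexConj L) ∘ ξ) ξ)
    (b : (Fp L)ˣ) (u : Fin 2 → L) (hu : ∃ k, u k = 1)
    (hne : ∃ (x : ι) (h : HA L e dV hdV dW hdW),
      fourierCoeffDelta L e dV hdV dW hdW νN βw
        ((-imagUnit L) • (((gramR L e dV hdV dW hdW).map (algebraMap (Fp L) L))⁻¹ *
          Matrix.reindex ρ.symm ρ.symm (algebraMap (Fp L) L (b : Fp L) • Matrix.vecMulVec (⇑(IsCMField.complexConj L) ∘ u) u))) (T x) h ≠ 0) :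
    ∃ e : L, algebraMap (Fp L) L (b : Fp L) = algebraMap (Fp L) L (a' : Fp L) * (IsCMField.complexConj L e * e) :=
  exists_eq_mul_conj_mul_self_of_support (IsCMField.complexConj L : L →+* L)
    (fun β => (β.map (IsCMField.complexConj L))ᵀ = β ∧ ∃ (x : ι) (h : HA L e dV hdV dW hdW),
      fourierCoeffDelta L e dV hdV dW hdW νN βw
        ((-imagUnit L) • (((gramR L e dV hdV dW hdW).map (algebraMap (Fp L) L))⁻¹ * Matrix.reindex ρ.symm ρ.symm β)) (T x) h ≠ 0)
    _ (fun β hβ => hfib β hβ.1 hβ.2) hu ⟨isHerm_smul_vecMulVec_conj L b u, hne⟩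

/-- **guarded `hfib` FROM THE GUARDED OUTPUTS OF THE RATIONAL κ-MULTIPLIER MODEL** (the shape of B3-2b∕B3-2c): B3-2b's support corollary on `T_L`-SKEW indices
(`hsupp`: «`S` skew, `cf_S ≠ 0 ⇒ ∃ ξ, Q ξ = S`» — nothing stronger is true, ★ `unipDeltaChar_eq_one_of_herm`) and B3-2c's Gram reading of the index map (`hQ`) give
the hermitian-guarded fibre letter: `dict′` of a hermitian `β` is skew (`dictNeg_mem_skewMatrices`) and `dict′` is injective (★ `dictNeg_injective`).
[cite: KudlaRallis1994, §3] [cite: Shimura1997, §18.1 (18.4)] [cite: Tan1999, §3] -/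
theorem hfib_of_indexMap_skew (hdV0 : ∀ i, dV i ≠ 0) (hdW0 : ∀ i, dW i ≠ 0) {ι X : Type*} (T : ι → HA L e dV hdV dW hdW → ℂ)
    (Q : X → Matrix (Fin n) (Fin n) L)
    (hQ : ∀ ξ : X, ∃ ξ' : Fin 2 → L, Q ξ = (-imagUnit L) • (((gramR L e dV hdV dW hdW).map (algebraMap (Fp L) L))⁻¹ *
      Matrix.reindex ρ.symm ρ.symm (algebraMap (Fp L) L (a' : Fp L) • Matrix.vecMulVec (⇑(IsCMField.complexConj L) ∘ ξ') ξ')))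
    (hsupp : ∀ S : Matrix (Fin n) (Fin n) L,
      S ∈ skewMatrices ((IsCMField.complexConj L : L ≃ₐ[Fp L] L) : L →+* L) ((gramR L e dV hdV dW hdW).map (algebraMap (Fp L) L)) →
      (∃ (x : ι) (h : HA L e dV hdV dW hdW), fourierCoeffDelta L e dV hdV dW hdW νN βw S (T x) h ≠ 0) → ∃ ξ : X, Q ξ = S) :
    ∀ β : Matrix (Fin 2) (Fin 2) L, (β.map (IsCMField.complexConj L))ᵀ = β →
      (∃ (x : ι) (h : HA L e dV hdV dW hdW),
        fourierCoeffDelta L e dV hdV dW hdW νN βw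
          ((-imagUnit L) • (((gramR L e dV hdV dW hdW).map (algebraMap (Fp L) L))⁻¹ * Matrix.reindex ρ.symm ρ.symm β)) (T x) h ≠ 0) →
      ∃ ξ : Fin 2 → L, β = algebraMap (Fp L) L (a' : Fp L) • Matrix.vecMulVec (⇑(IsCMField.complexConj L) ∘ ξ) ξ := by
  intro β hβ hne
  obtain ⟨ξ, hξ⟩ := hsupp _ (dictNeg_mem_skewMatrices L e dV hdV dW hdW ρ hdV0 hdW0 hβ) hne
  obtain ⟨ξ', hξ'⟩ := hQ ξ
  exact ⟨ξ', dictNeg_injective L e dV hdV dW hdW ρ hdV0 hdW0 (hξ.symm.trans hξ')⟩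

end Coeff

/-! ## §3 The theta side of record: `T₂ x = Θ̃_{𝓣 x}(fw)`, hermitian guard -/

section Theta

variable (L : Type) [Field L] [NumberField L] [IsCMField L]
variable {N n : ℕ} (e : Fin N × Fin 1 ≃ Fin n)
  (dV : Fin N → L) (hdV : ∀ i, IsCMField.complexConj L (dV i) = dV i)
  (dW : Fin 1 → L) (hdW : ∀ i, IsCMField.complexConj L (dW i) = dW i)
  {n'' : ℕ} (e₁ : Fin (n + n) × Fin 1 ≃ Fin n'')
  (hdV0 : ∀ i, dV i ≠ 0) (hdW0 : ∀ i, dW i ≠ 0)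
  (lam : IdeleClassGroup L →ₜ* Circle) (hlam : IsConjugateSymplectic L lam) (a' : (Fp L)ˣ)
  (hρ : HasThetaMajorants fun
      (p : ↥(UnitaryGroup.adelic (Fp L) L (IsCMField.complexConj L) (n + n) (Matrix.diagonal (dD L e dV hdV dW hdW))) ×
        ↥(UnitaryGroup.adelic (Fp L) L (IsCMField.complexConj L) 1 (JW (Fp L) L a')))
      (Φ : piSchwartzBruhat (Fp L) (Fin n'')) =>
        pairRep (Fp L) L (IsCMField.complexConj L) (n + n) 1 e₁ (Matrix.diagonal (dD L e dV hdV dW hdW)) (JW (Fp L) L a')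
          (chiSplittingLine L e₁ (dD L e dV hdV dW hdW) (dD_conj L e dV hdV dW hdW) (dD_ne_zero L e dV hdV dW hdW hdV0 hdW0)
            (toHeckeCharacter L lam) (isUnitary_toHeckeCharacter L lam)
            ((isOscillatorChar_toHeckeCharacter_iff lam).mpr hlam) (TW (Fp L) a')
            (isUnit_det_TW (Fp L) a') (JW (Fp L) L a') (JW_eq (Fp L) L a'))
          p Φ)
  [MeasurableSpace (↥(UnitaryGroup.adelic (Fp L) L (IsCMField.complexConj L) 1 (JW (Fp L) L a')) ⧸
    (UnitaryGroup.toAdelic (Fp L) L (IsCMField.complexConj L) 1 (JW (Fp L) L a')).range)]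
  (μW : Measure (↥(UnitaryGroup.adelic (Fp L) L (IsCMField.complexConj L) 1 (JW (Fp L) L a')) ⧸
    (UnitaryGroup.toAdelic (Fp L) L (IsCMField.complexConj L) 1 (JW (Fp L) L a')).range))
  (fw : C(↥(UnitaryGroup.adelic (Fp L) L (IsCMField.complexConj L) 1 (JW (Fp L) L a')) ⧸
    (UnitaryGroup.toAdelic (Fp L) L (IsCMField.complexConj L) 1 (JW (Fp L) L a')).range, ℂ))
  [MeasurableSpace (unipDelta L e dV hdV dW hdW)] (νN : Measure (unipDelta L e dV hdV dW hdW))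
  (βw : unipDelta L e dV hdV dW hdW → ℝ≥0∞) (ρ : Fin n ≃ Fin 2)

set_option maxHeartbeats 1000000 in -- the statement carries the line datum's `pairRep` telescope (as ★ p864604 ∕ ★ p865025)
/-- **B3-3 FOR THE THETA SIDE OF RECORD, HERMITIAN GUARD — `exists_globalGram_of_cf_thetaSide_ne_zero_herm`.**  As ★ p865025's §3 head, with the `Φ`-level fibre
letter of B3-2 guarded on hermitian `β` (`hfibΘ`: for `(β.map c)ᵀ = β`, a non-zero coefficient of some `Θ̃_Φ(fw)` at `(−δ) • (T_L⁻¹ · β^{ρ⁻¹})` forces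
`β = a′ · ξ̄ ⊗ ξ`): ED. 2's `hsign₂′`-premise «the coefficient of some `T₂ x` at the index of `b • ū ⊗ u` is non-zero at some `h`» ⇒ `b = a′ · c(e) · e`.
[cite: KudlaRallis1994, §3] [cite: Liu2021, Def. 4.11–4.12; App. B Prop. B.8 p. 104] [cite: Scharlau1985HermitianForms, Ch. 10 §1] -/
theorem exists_globalGram_of_cf_thetaSide_ne_zero_herm {D : Type*} (𝓣 : D → piSchwartzBruhat (Fp L) (Fin n'')) (T₂ : D → HA L e dV hdV dW hdW → ℂ)
    (hT₂B : ∀ x (h : HA L e dV hdV dW hdW), T₂ x h = doubledLineThetaLift L e dV hdV dW hdW e₁ hdV0 hdW0 lam hlam a' hρ μW (𝓣 x) fw h)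
    (hfibΘ : ∀ β : Matrix (Fin 2) (Fin 2) L, (β.map (IsCMField.complexConj L))ᵀ = β →
      (∃ (Φ : piSchwartzBruhat (Fp L) (Fin n'')) (h : HA L e dV hdV dW hdW),
        fourierCoeffDelta L e dV hdV dW hdW νN βw
          ((-imagUnit L) • (((gramR L e dV hdV dW hdW).map (algebraMap (Fp L) L))⁻¹ * Matrix.reindex ρ.symm ρ.symm β))
          (doubledLineThetaLift L e dV hdV dW hdW e₁ hdV0 hdW0 lam hlam a' hρ μW Φ fw) h ≠ 0) →
      ∃ ξ : Fin 2 → L, β = algebraMap (Fp L) L (a' : Fp L) • Matrix.vecMulVec (⇑(IsCMField.complexConj L) ∘ ξ) ξ)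
    (b : (Fp L)ˣ) (u : Fin 2 → L) (hu : ∃ k, u k = 1)
    (hne : ∃ (x : D) (h : HA L e dV hdV dW hdW),
      fourierCoeffDelta L e dV hdV dW hdW νN βw
        ((-imagUnit L) • (((gramR L e dV hdV dW hdW).map (algebraMap (Fp L) L))⁻¹ *
          Matrix.reindex ρ.symm ρ.symm (algebraMap (Fp L) L (b : Fp L) • Matrix.vecMulVec (⇑(IsCMField.complexConj L) ∘ u) u))) (T₂ x) h ≠ 0) :
    ∃ e : L, algebraMap (Fp L) L (b : Fp L) = algebraMap (Fp L) L (a' : Fp L) * (IsCMField.complexConj L e * e) := by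
  refine exists_globalGram_of_fourierCoeff_ne_zero_herm L e dV hdV dW hdW νN βw ρ a'
    (fun Φ => doubledLineThetaLift L e dV hdV dW hdW e₁ hdV0 hdW0 lam hlam a' hρ μW Φ fw) hfibΘ b u hu ?_
  obtain ⟨x, h, hxh⟩ := hne
  have hx : T₂ x = doubledLineThetaLift L e dV hdV dW hdW e₁ hdV0 hdW0 lam hlam a' hρ μW (𝓣 x) fw := funext (hT₂B x)
  exact ⟨𝓣 x, h, hx ▸ hxh⟩

end Theta

end Summit.HodgeConjecture.HodgeConjecture.Cruxes.HLiu418.K2LiuThetaSideRankOneIndexGlobalGramHerm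

end
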